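import Summits.Ventures.PackingBounds.ThreePointCert.SoundExactParts
import Summits.Ventures.PackingBounds.ThreePointCert.SoundExactF
import Summits.Ventures.PackingBounds.ThreePointCert.CheckExact2

/-!
# Soundness of the exact three-point certificate checker, V: the checks

Framing: lottery ticket; floor = certified bounds/negative ranges. Venture `PackingBounds`
(cell `pub-packcert`), three-point SDP family.

From the kernel checks of `ThreePointCert.CheckExact` (`checkSideX`, `checkIIX`, `checkIZ`, `checkH`,
`checkValX`) and validated expansion data (`PolysOKX`) to the analytic facts about
`A(u) = AvalG/Λ` and `F = FvalX/Λ` that `SphericalCodes.card_le_98_of_exact99_certificate` consumes: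
three-point positivity and symmetry of `F`, `F ≤ 0` on the Gram-feasible part of `[-1,s]³`,
`A(u) + 3F(u,u,1) ≤ -1` on `[-1,s]` with equality only where the data polynomial `w` vanishes, and the
exact value `1 + A(1) + F(1,1,1) = N`.
-/

noncomputable section

open Finset
open scoped RealInnerProductSpace

namespace Summit.Ventures.PackingBounds.ThreePointCert

open Literature.Geometry.DiscreteGeometry Literature.Geometry.DiscreteGeometry.PolyCert
open Literature.Geometry.DiscreteGeometry.PolyCert.SPoly
open Literature.Analysis.SpecialFunctions

/-! ### Validity of the expansion data -/

/-- Block-chunk validity of the three-point expansion on values (everywhere). -/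
def FChunkValX (c : CertX) (bs : List FBlkX) (Dprev Dnext : SPoly) : Prop :=
  ∀ u v t : ℝ, eval Dnext u v t = eval Dprev u v t + eval (FPolyX c.n c.d bs) u v t

/-- A kernel block-chunk check gives chunk validity. -/
theorem fchunkValX_of_ok (c : CertX) (bs : List FBlkX) (Dprev Dnext : SPoly)
    (h : FchunkOKX c.n c.d bs Dprev Dnext = true) : FChunkValX c bs Dprev Dnext := by
  intro u v t
  have h0 := eval_eq_zero_of_allZero _ h u v t
  rw [eval_mergeAll] at h0
  simp only [List.map_cons, List.map_nil, List.sum_cons, List.sum_nil, add_zero, eval_neg] at h0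
  linarith

/-- `FPolyX` is additive in the block list (on values). -/
theorem eval_FPolyX_append (n d : ℕ) (l₁ l₂ : List FBlkX) (u v t : ℝ) :
    eval (FPolyX n d (l₁ ++ l₂)) u v t = eval (FPolyX n d l₁) u v t + eval (FPolyX n d l₂) u v t := by
  simp [FPolyX, eval_mergeAll, List.map_append, List.sum_append]

/-- Consecutive block chunks compose. -/
theorem fchunkValX_append (c : CertX) (l₁ l₂ : List FBlkX) (D0 D1 D2 : SPoly)
    (h1 : FChunkValX c l₁ D0 D1) (h2 : FChunkValX c l₂ D1 D2) : FChunkValX c (l₁ ++ l₂) D0 D2 := by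
  intro u v t
  rw [h2 u v t, h1 u v t, eval_FPolyX_append]; ring

/-- Validity of all expansion data of an exact certificate. -/
structure PolysOKX (c : CertX) (P : PolysX) (gh0 gh1 : GramBlk) : Prop where
  /-- the three-point expansion -/
  hF : FChunkValX c c.F [] P.FP
  /-- the parts of the multiplier `1` -/
  hT0 : PartsVal c.R0 (P.TOT.getD 0 [])
  /-- the parts of `m₁` -/
  hT1 : PartsVal c.R1 (P.TOT.getD 1 [])
  /-- the parts of `m₂` -/
  hT2 : PartsVal c.R2 (P.TOT.getD 2 [])
  /-- the parts of `m₃` -/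
  hT3 : PartsVal c.R3 (P.TOT.getD 3 [])
  /-- the parts of `s₄` -/
  hT4 : PartsVal c.R4 (P.TOT.getD 4 [])
  /-- Gram expansion for the multiplier `1` of the positivity certificate of `h` -/
  hh0 : RValid gh0 P.EH0
  /-- Gram expansion for the multiplier `g_q` -/
  hh1 : RValid gh1 P.EH1

/-- Unpacked side conditions. -/
theorem sideX_of_check (c : CertX) (hs : checkSideX c = true) :
    4 ≤ c.n ∧ 0 < c.q ∧ c.p ≤ (c.q : ℤ) ∧ -(c.q : ℤ) ≤ c.p ∧ 0 < c.lam ∧ c.A.length = c.d + 1 ∧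
      (∀ b ∈ c.F, fblkShapeOK c.d b = true) ∧ (∀ Pt ∈ c.R0, partShapeOK Pt = true) ∧
      (∀ Pt ∈ c.R1, partShapeOK Pt = true) ∧ (∀ Pt ∈ c.R2, partShapeOK Pt = true) ∧
      (∀ Pt ∈ c.R3, partShapeOK Pt = true) ∧ (∀ Pt ∈ c.R4, partShapeOK Pt = true) := by
  unfold checkSideX at hs
  simp only [Bool.and_eq_true, decide_eq_true_eq, List.all_eq_true] at hs
  obtain ⟨⟨⟨⟨⟨⟨⟨⟨⟨⟨⟨h1, h2⟩, h3⟩, h4⟩, h5⟩, h6⟩, h7⟩, h8⟩, h9⟩, h10⟩, h11⟩, h12⟩ := hs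
  exact ⟨h1, h2, h3, h4, h5, h6, h7, h8, h9, h10, h11, h12⟩

/-- The two-point function of an exact certificate: `A(u) = AvalG/Λ`. -/
def AX (c : CertX) (u : ℝ) : ℝ := AvalG c.n c.A u / c.lam

/-- The three-point function of an exact certificate: `F = FvalX/Λ`. -/
def FX (c : CertX) (u v t : ℝ) : ℝ := FvalX c.n c.F u v t / c.lam

/-- Value of the validated three-point expansion. -/
theorem eval_FP_eq (c : CertX) (P : PolysX) {gh0 gh1 : GramBlk} (hP : PolysOKX c P gh0 gh1)
    (hs : checkSideX c = true) (u v t : ℝ) :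
    eval P.FP u v t = (Wfac c.d : ℝ) * (c.lam : ℝ) * FX c u v t := by
  obtain ⟨-, -, -, -, hlam, -, hF, -⟩ := sideX_of_check c hs
  have hl : (0 : ℝ) < c.lam := by exact_mod_cast hlam
  rw [hP.hF u v t, eval_nil, zero_add, eval_FPolyX c.n c.d c.F hF, FX]
  field_simp

/-- A sum of valid parts is nonnegative everywhere. -/
theorem partsVal_nonneg (Ps : List SymPart) (T : SPoly) (h : PartsVal Ps T) (hs : ∀ Pt ∈ Ps, partShapeOK Pt = true)
    (u v t : ℝ) : 0 ≤ eval T u v t := by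
  rw [h u v t]
  refine List.sum_nonneg ?_
  intro x hx
  rw [List.mem_map] at hx
  obtain ⟨Pt, hPt, rfl⟩ := hx
  exact partVal_nonneg Pt (hs Pt hPt) u v t

set_option maxHeartbeats 4000000 in
/-- The evaluated identity of `(ii)` forces `F ≤ 0` on the Gram-feasible part of `[-1, s]³`. -/
theorem FX_nonpos_of_identity (c : CertX) (P : PolysX) {gh0 gh1 : GramBlk} (hP : PolysOKX c P gh0 gh1)
    (hs : checkSideX c = true) (hkF : 0 < c.kF) (u v t : ℝ)
    (h0 : (c.kF : ℝ) * eval P.FP u v t + (c.kR.getD 0 0 : ℕ) * eval (P.TOT.getD 0 []) u v t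
      + eval (m1P c.p c.q) u v t * ((c.kR.getD 1 0 : ℕ) * eval (P.TOT.getD 1 []) u v t)
      + eval (m2P c.p c.q) u v t * ((c.kR.getD 2 0 : ℕ) * eval (P.TOT.getD 2 []) u v t)
      + eval (m3P c.p c.q) u v t * ((c.kR.getD 3 0 : ℕ) * eval (P.TOT.getD 3 []) u v t)
      + eval p4 u v t * ((c.kR.getD 4 0 : ℕ) * eval (P.TOT.getD 4 []) u v t) = 0)
    (hu : -1 ≤ u) (hu' : u ≤ (c.p : ℝ) / c.q) (hv : -1 ≤ v) (hv' : v ≤ (c.p : ℝ) / c.q)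
    (ht : -1 ≤ t) (ht' : t ≤ (c.p : ℝ) / c.q) (hp : 0 ≤ 1 + 2 * u * v * t - u ^ 2 - v ^ 2 - t ^ 2) :
    FX c u v t ≤ 0 := by
  obtain ⟨hn, hq, hpq, _, hlam, _, hFs, h0s, h1s, h2s, h3s, h4s⟩ := sideX_of_check c hs
  rw [eval_m1P, eval_m2P, eval_m3P, eval_p4, eval_FP_eq c P hP hs] at h0
  have gu := gq_nonneg c.p c.q u hu (qmul_le_of_box c.p c.q hq u hu')
  have gv := gq_nonneg c.p c.q v hv (qmul_le_of_box c.p c.q hq v hv')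
  have gt := gq_nonneg c.p c.q t ht (qmul_le_of_box c.p c.q hq t ht')
  have e0 := partsVal_nonneg c.R0 _ hP.hT0 h0s u v t
  have e1 := partsVal_nonneg c.R1 _ hP.hT1 h1s u v t
  have e2 := partsVal_nonneg c.R2 _ hP.hT2 h2s u v t
  have e3 := partsVal_nonneg c.R3 _ hP.hT3 h3s u v t
  have e4 := partsVal_nonneg c.R4 _ hP.hT4 h4s u v t
  have hW : (0 : ℝ) < Wfac c.d := by exact_mod_cast Wfac_pos c.d
  have hl : (0 : ℝ) < c.lam := by exact_mod_cast hlam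
  have hk : (0 : ℝ) < c.kF := by exact_mod_cast hkF
  generalize eval (P.TOT.getD 0 []) u v t = r0 at *
  generalize eval (P.TOT.getD 1 []) u v t = r1 at *
  generalize eval (P.TOT.getD 2 []) u v t = r2 at *
  generalize eval (P.TOT.getD 3 []) u v t = r3 at *
  generalize eval (P.TOT.getD 4 []) u v t = r4 at *
  generalize (u + 1) * ((c.p : ℝ) - c.q * u) = a1 at *
  generalize (v + 1) * ((c.p : ℝ) - c.q * v) = a2 at *
  generalize (t + 1) * ((c.p : ℝ) - c.q * t) = a3 at *
  have k0 : (0 : ℝ) ≤ (c.kR.getD 0 0 : ℕ) := Nat.cast_nonneg _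
  have k1 : (0 : ℝ) ≤ (c.kR.getD 1 0 : ℕ) := Nat.cast_nonneg _
  have k2 : (0 : ℝ) ≤ (c.kR.getD 2 0 : ℕ) := Nat.cast_nonneg _
  have k3 : (0 : ℝ) ≤ (c.kR.getD 3 0 : ℕ) := Nat.cast_nonneg _
  have k4 : (0 : ℝ) ≤ (c.kR.getD 4 0 : ℕ) := Nat.cast_nonneg _
  have m12 := mul_nonneg gu gv
  have m13 := mul_nonneg gu gt
  have m23 := mul_nonneg gv gt
  have m123 := mul_nonneg gu (mul_nonneg gv gt)
  have hrest : 0 ≤ (c.kR.getD 0 0 : ℕ) * r0 + (a1 + a2 + a3) * ((c.kR.getD 1 0 : ℕ) * r1)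
      + (a1 * a2 + a1 * a3 + a2 * a3) * ((c.kR.getD 2 0 : ℕ) * r2) + a1 * (a2 * a3) * ((c.kR.getD 3 0 : ℕ) * r3)
      + (1 + 2 * u * v * t - u ^ 2 - v ^ 2 - t ^ 2) * ((c.kR.getD 4 0 : ℕ) * r4) := by
    have t0 := mul_nonneg k0 e0
    have t1 := mul_nonneg (add_nonneg (add_nonneg gu gv) gt) (mul_nonneg k1 e1)
    have t2 := mul_nonneg (add_nonneg (add_nonneg m12 m13) m23) (mul_nonneg k2 e2)
    have t3 := mul_nonneg m123 (mul_nonneg k3 e3)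
    have t4 := mul_nonneg hp (mul_nonneg k4 e4)
    linarith
  have key : (c.kF : ℝ) * ((Wfac c.d : ℝ) * (c.lam : ℝ) * FX c u v t) ≤ 0 := by
    linarith
  have hpos : (0 : ℝ) < (c.kF : ℝ) * ((Wfac c.d : ℝ) * (c.lam : ℝ)) := by positivity
  by_contra hneg
  have hneg' : 0 < FX c u v t := lt_of_not_ge hneg
  have : 0 < (c.kF : ℝ) * ((Wfac c.d : ℝ) * (c.lam : ℝ) * FX c u v t) := by
    have := mul_pos hpos hneg'
    linarith [this]
  linarith

set_option maxHeartbeats 4000000 in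
/-- **Soundness of `(ii)`**: on the Gram-feasible part of `[-1, s]³`, `F ≤ 0`. -/
theorem FX_nonpos_of_check (c : CertX) (P : PolysX) {gh0 gh1 : GramBlk} (hP : PolysOKX c P gh0 gh1)
    (hII : checkIIX c P = true) (hs : checkSideX c = true) (u v t : ℝ)
    (hu : -1 ≤ u) (hu' : u ≤ (c.p : ℝ) / c.q) (hv : -1 ≤ v) (hv' : v ≤ (c.p : ℝ) / c.q)
    (ht : -1 ≤ t) (ht' : t ≤ (c.p : ℝ) / c.q) (hp : 0 ≤ 1 + 2 * u * v * t - u ^ 2 - v ^ 2 - t ^ 2) :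
    FX c u v t ≤ 0 := by
  unfold checkIIX at hII
  simp only [Bool.and_eq_true, decide_eq_true_eq] at hII
  obtain ⟨⟨⟨hkF, -⟩, -⟩, hz⟩ := hII
  have h0 := eval_eq_zero_of_allZero _ hz u v t
  clear hz
  rw [eval_mergeAll] at h0
  simp only [List.map_cons, List.map_nil, List.sum_cons, List.sum_nil, add_zero, eval_smul, eval_mulN,
    Int.cast_natCast] at h0
  refine FX_nonpos_of_identity c P hP hs hkF u v t ?_ hu hu' hv hv' ht ht' hp
  linarith

set_option maxHeartbeats 4000000 in
/-- **Soundness of `(ii)`, pre-multiplied form**: with `P_i ≡ m_i · (κ_i · TOT_i)` validated by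
`mulOK` and the identity checked by `checkIIX2`, `F ≤ 0` on the Gram-feasible part of `[-1, s]³`. -/
theorem FX_nonpos_of_check2 (c : CertX) (P : PolysX) {gh0 gh1 : GramBlk} (hP : PolysOKX c P gh0 gh1)
    (P1 P2 P3 P4 : SPoly) (hII : checkIIX2 c P P1 P2 P3 P4 = true)
    (hm1 : mulOK (m1P c.p c.q) (c.kR.getD 1 0) (P.TOT.getD 1 []) P1 = true)
    (hm2 : mulOK (m2P c.p c.q) (c.kR.getD 2 0) (P.TOT.getD 2 []) P2 = true)
    (hm3 : mulOK (m3P c.p c.q) (c.kR.getD 3 0) (P.TOT.getD 3 []) P3 = true)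
    (hm4 : mulOK p4 (c.kR.getD 4 0) (P.TOT.getD 4 []) P4 = true)
    (hs : checkSideX c = true) (u v t : ℝ)
    (hu : -1 ≤ u) (hu' : u ≤ (c.p : ℝ) / c.q) (hv : -1 ≤ v) (hv' : v ≤ (c.p : ℝ) / c.q)
    (ht : -1 ≤ t) (ht' : t ≤ (c.p : ℝ) / c.q) (hp : 0 ≤ 1 + 2 * u * v * t - u ^ 2 - v ^ 2 - t ^ 2) :
    FX c u v t ≤ 0 := by
  unfold checkIIX2 at hII
  simp only [Bool.and_eq_true, decide_eq_true_eq] at hII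
  obtain ⟨⟨⟨hkF, -⟩, -⟩, hz⟩ := hII
  have h0 := eval_eq_zero_of_allZero _ hz u v t
  have g1 := eval_eq_zero_of_allZero _ hm1 u v t
  have g2 := eval_eq_zero_of_allZero _ hm2 u v t
  have g3 := eval_eq_zero_of_allZero _ hm3 u v t
  have g4 := eval_eq_zero_of_allZero _ hm4 u v t
  clear hz hm1 hm2 hm3 hm4
  rw [eval_mergeAll] at h0 g1 g2 g3 g4
  simp only [List.map_cons, List.map_nil, List.sum_cons, List.sum_nil, add_zero, eval_smul, eval_mulN,
    eval_neg, Int.cast_natCast] at h0 g1 g2 g3 g4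
  refine FX_nonpos_of_identity c P hP hs hkF u v t ?_ hu hu' hv hv' ht ht' hp
  linarith

set_option maxHeartbeats 4000000 in
/-- **Soundness of `(i)`**: on `[-1, s]`, `κ_Z Λ W (-1 - A(u) - 3F(u,u,1)) = w(u) h(u)` with `h(u) > 0`;
hence `A(u) + 3F(u,u,1) ≤ -1` wherever `w(u) ≥ 0`, with equality only where `w(u) = 0`. -/
theorem AFX_of_check (c : CertX) (P : PolysX) {gh0 gh1 : GramBlk} (hP : PolysOKX c P gh0 gh1)
    (hI : checkIZ c P = true) (hH : checkH c P = true) (hs : checkSideX c = true)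
    (u : ℝ) (hu : -1 ≤ u) (hu' : u ≤ (c.p : ℝ) / c.q) (hw : 0 ≤ eval c.wP u 0 0) :
    AX c u + 3 * FX c u u 1 ≤ -1 ∧ (AX c u + 3 * FX c u u 1 = -1 → eval c.wP u 0 0 = 0) := by
  obtain ⟨hn, hq, hpq, _, hlam, hAlen, hFs, -⟩ := sideX_of_check c hs
  have hu1 := abs_le_one_of_box c.p c.q hq hpq u hu hu'
  have h01 : |(0 : ℝ)| ≤ 1 := by norm_num
  have gu := gq_nonneg c.p c.q u hu (qmul_le_of_box c.p c.q hq u hu')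
  have hW : (0 : ℝ) < Wfac c.d := by exact_mod_cast Wfac_pos c.d
  have hl : (0 : ℝ) < c.lam := by exact_mod_cast hlam
  -- h(u) > 0 from the slackful certificate
  unfold checkH at hH
  have hle := of_decide_eq_true hH
  have hres := (abs_eval_le _ hu1 h01 h01).trans_lt (Nat.cast_lt.2 hle)
  clear hle hH
  rw [eval_mergeAll] at hres
  simp only [List.map_cons, List.map_nil, List.sum_cons, List.sum_nil, add_zero, eval_neg, eval_C,
    eval_smul, eval_mulN, eval_gqU, Int.cast_natCast] at hres
  have e0 := eval_nonneg_of_rvalid gh0 P.EH0 hP.hh0 u 0 0 hu1 h01 h01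
  have e1 := eval_nonneg_of_rvalid gh1 P.EH1 hP.hh1 u 0 0 hu1 h01 h01
  have hh : 0 < (c.kH : ℝ) * eval c.hP u 0 0 := by
    have h1 := (abs_lt.1 hres).1
    nlinarith [mul_nonneg gu e1]
  have hhpos : 0 < eval c.hP u 0 0 := by
    rcases lt_trichotomy (eval c.hP u 0 0) 0 with h | h | h
    · have : (c.kH : ℝ) * eval c.hP u 0 0 ≤ 0 := mul_nonpos_of_nonneg_of_nonpos (Nat.cast_nonneg _) h.le
      linarith
    · rw [h, mul_zero] at hh; exact absurd hh (lt_irrefl 0)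
    · exact h
  -- the exact factorisation
  unfold checkIZ at hI
  simp only [Bool.and_eq_true, decide_eq_true_eq] at hI
  obtain ⟨hkZ, hz⟩ := hI
  have h0 := eval_eq_zero_of_allZero _ hz u 0 0
  clear hz
  rw [eval_mergeAll] at h0
  simp only [List.map_cons, List.map_nil, List.sum_cons, List.sum_nil, add_zero, eval_neg, eval_smul,
    eval_mulN, ZIX, eval_normalize, eval_append, eval_C, eval_substUU1, eval_APolyG c.n c.d c.A hAlen.le,
    eval_FP_eq c P hP hs] at h0
  -- h0 : κZ · (-(ΛW + W·AvalG + 3 W Λ F(u,u,1))) - w h = 0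
  have hk : (0 : ℝ) < c.kZ := by exact_mod_cast hkZ
  have hLW : ((c.LW : ℕ) : ℝ) = (c.lam : ℝ) * (Wfac c.d : ℝ) := by simp [CertX.LW]
  push_cast at h0
  rw [hLW] at h0
  have hAX : AvalG c.n c.A u = (c.lam : ℝ) * AX c u := by
    unfold AX; field_simp
  rw [hAX] at h0
  -- key identity: κZ Λ W (-1 - AX - 3 FX) = w h
  have key : (c.kZ : ℝ) * ((c.lam : ℝ) * (Wfac c.d : ℝ)) * (-1 - AX c u - 3 * FX c u u 1) =
      eval c.wP u 0 0 * eval c.hP u 0 0 := by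
    linarith
  have hpos : (0 : ℝ) < (c.kZ : ℝ) * ((c.lam : ℝ) * (Wfac c.d : ℝ)) := by positivity
  constructor
  · have : 0 ≤ (c.kZ : ℝ) * ((c.lam : ℝ) * (Wfac c.d : ℝ)) * (-1 - AX c u - 3 * FX c u u 1) := by
      rw [key]; exact mul_nonneg hw hhpos.le
    have h2 : 0 ≤ -1 - AX c u - 3 * FX c u u 1 := by
      by_contra hneg
      have hneg' : -1 - AX c u - 3 * FX c u u 1 < 0 := lt_of_not_ge hneg
      have := mul_neg_of_pos_of_neg hpos hneg'
      linarith
    linarith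
  · intro heq
    have : (c.kZ : ℝ) * ((c.lam : ℝ) * (Wfac c.d : ℝ)) * (-1 - AX c u - 3 * FX c u u 1) = 0 := by
      have hz0 : -1 - AX c u - 3 * FX c u u 1 = 0 := by linarith
      rw [hz0, mul_zero]
    rw [key] at this
    rcases mul_eq_zero.1 this with h | h
    · exact h
    · exact absurd h hhpos.ne'

/-- **The exact value**: `1 + A(1) + F(1,1,1) = N`. -/
theorem valX_of_check (c : CertX) (P : PolysX) {gh0 gh1 : GramBlk} (hP : PolysOKX c P gh0 gh1)
    (hV : checkValX c P = true) (hs : checkSideX c = true) : 1 + AX c 1 + FX c 1 1 1 = c.N := by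
  obtain ⟨hn, hq, hpq, _, hlam, hAlen, hFs, -⟩ := sideX_of_check c hs
  unfold checkValX at hV
  have h := of_decide_eq_true hV
  clear hV
  have hW : (0 : ℝ) < Wfac c.d := by exact_mod_cast Wfac_pos c.d
  have hl : (0 : ℝ) < c.lam := by exact_mod_cast hlam
  have hAv : (coeffSum (APolyG c.n c.d c.A) : ℝ) = (Wfac c.d : ℝ) * AvalG c.n c.A 1 := by
    rw [← eval_one_one_one, eval_APolyG c.n c.d c.A hAlen.le]
  have hFv : (coeffSum P.FP : ℝ) = (Wfac c.d : ℝ) * (c.lam : ℝ) * FX c 1 1 1 := by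
    rw [← eval_one_one_one, eval_FP_eq c P hP hs]
  have h' : ((c.LW : ℕ) : ℝ) + (coeffSum (APolyG c.n c.d c.A) : ℝ) + (coeffSum P.FP : ℝ) = (c.N : ℝ) * (c.LW : ℕ) := by
    exact_mod_cast h
  have hLW : ((c.LW : ℕ) : ℝ) = (c.lam : ℝ) * (Wfac c.d : ℝ) := by simp [CertX.LW]
  rw [hAv, hFv, hLW] at h'
  have hAX : AvalG c.n c.A 1 = (c.lam : ℝ) * AX c 1 := by unfold AX; field_simp
  rw [hAX] at h'
  have hlw : (0 : ℝ) < (c.lam : ℝ) * (Wfac c.d : ℝ) := mul_pos hl hW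
  have : (c.lam : ℝ) * (Wfac c.d : ℝ) * (1 + AX c 1 + FX c 1 1 1 - c.N) = 0 := by linarith
  rcases mul_eq_zero.1 this with h | h
  · exact absurd h hlw.ne'
  · linarith

/-- **Three-point positivity of `F`.** -/
theorem tripleSum_FX_nonneg (c : CertX) (hs : checkSideX c = true)
    (C : Finset (EuclideanSpace ℝ (Fin c.n))) (hC : ∀ x ∈ C, ‖x‖ = 1) :
    0 ≤ BachocVallentin.tripleSum C (FX c) := by
  obtain ⟨hn, -, -, -, hlam, -, hFs, -⟩ := sideX_of_check c hs
  have hl : (0 : ℝ) < c.lam := by exact_mod_cast hlam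
  have h0 := tripleSum_FvalX_nonneg hn c.d c.F hFs C hC
  unfold FX
  unfold BachocVallentin.tripleSum at h0 ⊢
  have e : (∑ x ∈ C, ∑ y ∈ C, ∑ z ∈ C,
      FvalX c.n c.F (inner ℝ x y) (inner ℝ x z) (inner ℝ y z) / (c.lam : ℝ))
      = (∑ x ∈ C, ∑ y ∈ C, ∑ z ∈ C,
        FvalX c.n c.F (inner ℝ x y) (inner ℝ x z) (inner ℝ y z)) / (c.lam : ℝ) := by
    rw [Finset.sum_div]; refine Finset.sum_congr rfl fun x _ => ?_
    rw [Finset.sum_div]; refine Finset.sum_congr rfl fun y _ => ?_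
    rw [Finset.sum_div]
  rw [e]; exact div_nonneg h0 hl.le

/-- `F` is symmetric in its first two arguments. -/
theorem FX_swap12 (c : CertX) (u v t : ℝ) : FX c u v t = FX c v u t := by
  unfold FX; rw [FvalX_swap12]

/-- `F` is symmetric in its last two arguments. -/
theorem FX_swap23 (c : CertX) (u v t : ℝ) : FX c u v t = FX c u t v := by
  unfold FX; rw [FvalX_swap23]

/-- `A(u) = Σ_{k < |A|} (A_k/Λ) C_k^{(n-2)/2}(u)`. -/
theorem AX_eq_sum (c : CertX) (u : ℝ) :
    AX c u = ∑ k ∈ range c.A.length, ((c.A.getD k 0 : ℝ) / c.lam) * gegenbauerSum (((c.n : ℝ) - 2) / 2) k u := by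
  unfold AX AvalG
  rw [Finset.sum_div]
  refine Finset.sum_congr rfl fun k _ => ?_
  ring

end Summit.Ventures.PackingBounds.ThreePointCert

end
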